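import Mathlib

/-!
# PfPersistence — same-window orthogonality identity and planted-pair leverage

Bookkeeping identities of the pub-rhpf mechanism/rigidity campaign (no RH claims; Mathlib-only
linear algebra, [folklore]), landed at the request of `pub-rhpf-struct` (STRUCTURE-D9 §A5, §B2 (1);
GAP rows S9-N2 / S9-N3).

1. **Same-window orthogonality** (`sameWindow_identity`): for real symmetric matrices `A` (ζ's window
   form) and `S` (a perturbation; the twin is `A + S`), if `A v = lam • v` and `(A + S) u = mu • u` then
   `(mu - lam) * ⟨u, v⟩ = ⟨u, S v⟩`; hence (`sameWindow_overlap_sq_bound`, `sameWindow_overlap_bound`)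
   `|⟨u, v⟩| ≤ ‖u‖ ‖S v‖ / |mu - lam|`: the twin intruder's overlap with ζ's eigenvector is bounded by the
   perturbation applied to the UNPERTURBED eigenvector over the level gap (DATA side: twin64, 72/72
   windows ≤ 1.3e-17 — not part of this file).
2. **Leverage of a planted rank-one term** (`leverage_eq`, `leverage_pos`, `leverage_le_one`): for `R`
   positive definite, `q > 0` and any `φ`, the leverage
   `ι := 1 - q φᵀ (R + q φ φᵀ)⁻¹ φ = 1 / (1 + q φᵀ R⁻¹ φ) ∈ (0, 1]` (Sherman–Morrison, proved here by
   exhibiting the solve `(R + q φ φᵀ)⁻¹ φ = (1 + q φᵀR⁻¹φ)⁻¹ R⁻¹ φ`); in particular the leverage cannot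
   change sign.
-/

set_option linter.dupNamespace false  -- the mandated namespace repeats `RiemannHypothesis`

namespace Summit.RiemannHypothesis.RiemannHypothesis.Theorems.PfPersistence.SameWindow

open Matrix

variable {n : Type*} [Fintype n]

/-- A symmetric real matrix moves across the dot product. [folklore] -/
theorem mulVec_dotProduct_of_isSymm {A : Matrix n n ℝ} (hA : A.IsSymm) (u v : n → ℝ) :
    (A *ᵥ u) ⬝ᵥ v = u ⬝ᵥ (A *ᵥ v) := by
  rw [dotProduct_mulVec, ← mulVec_transpose, hA.eq]

/-- **Same-window orthogonality identity.** If `A v = lam v` and `(A + S) u = mu u` with `A`, `S`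
symmetric, then `(mu - lam) ⟨u, v⟩ = ⟨u, S v⟩`. [folklore] -/
theorem sameWindow_identity (A S : Matrix n n ℝ) (hA : A.IsSymm) (hS : S.IsSymm)
    (u v : n → ℝ) (lam mu : ℝ) (hv : A *ᵥ v = lam • v) (hu : (A + S) *ᵥ u = mu • u) :
    (mu - lam) * (u ⬝ᵥ v) = u ⬝ᵥ (S *ᵥ v) := by
  have h1 : ((A + S) *ᵥ u) ⬝ᵥ v = mu * (u ⬝ᵥ v) := by
    rw [hu, smul_dotProduct, smul_eq_mul]
  have h2 : ((A + S) *ᵥ u) ⬝ᵥ v = lam * (u ⬝ᵥ v) + u ⬝ᵥ (S *ᵥ v) := by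
    rw [add_mulVec, add_dotProduct, mulVec_dotProduct_of_isSymm hA, mulVec_dotProduct_of_isSymm hS,
      hv, dotProduct_smul, smul_eq_mul]
  linear_combination h2 - h1

/-- Squared overlap bound: `(mu - lam)² ⟨u,v⟩² ≤ ⟨u,u⟩ ⟨Sv,Sv⟩` (Cauchy–Schwarz). [folklore] -/
theorem sameWindow_overlap_sq_bound (A S : Matrix n n ℝ) (hA : A.IsSymm) (hS : S.IsSymm)
    (u v : n → ℝ) (lam mu : ℝ) (hv : A *ᵥ v = lam • v) (hu : (A + S) *ᵥ u = mu • u) :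
    (mu - lam) ^ 2 * (u ⬝ᵥ v) ^ 2 ≤ (u ⬝ᵥ u) * ((S *ᵥ v) ⬝ᵥ (S *ᵥ v)) := by
  have h := sameWindow_identity A S hA hS u v lam mu hv hu
  have hcs := Finset.sum_mul_sq_le_sq_mul_sq Finset.univ u (S *ᵥ v)
  have e1 : (mu - lam) ^ 2 * (u ⬝ᵥ v) ^ 2 = (u ⬝ᵥ (S *ᵥ v)) ^ 2 := by rw [← h]; ring
  rw [e1]
  simpa only [dotProduct, sq] using hcs

/-- **Overlap bound.** `|⟨u, v⟩| ≤ √⟨u,u⟩ · √⟨Sv,Sv⟩ / |mu - lam|` for `mu ≠ lam`. [folklore] -/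
theorem sameWindow_overlap_bound (A S : Matrix n n ℝ) (hA : A.IsSymm) (hS : S.IsSymm)
    (u v : n → ℝ) (lam mu : ℝ) (hgap : mu ≠ lam)
    (hv : A *ᵥ v = lam • v) (hu : (A + S) *ᵥ u = mu • u) :
    |u ⬝ᵥ v| ≤ Real.sqrt (u ⬝ᵥ u) * Real.sqrt ((S *ᵥ v) ⬝ᵥ (S *ᵥ v)) / |mu - lam| := by
  have h := sameWindow_identity A S hA hS u v lam mu hv hu
  have hcs : (u ⬝ᵥ (S *ᵥ v)) ^ 2 ≤ (u ⬝ᵥ u) * ((S *ᵥ v) ⬝ᵥ (S *ᵥ v)) := by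
    simpa only [dotProduct, sq] using Finset.sum_mul_sq_le_sq_mul_sq Finset.univ u (S *ᵥ v)
  have hpos : 0 < |mu - lam| := abs_pos.mpr (sub_ne_zero.mpr hgap)
  have huu : 0 ≤ u ⬝ᵥ u := Finset.sum_nonneg fun i _ => mul_self_nonneg (u i)
  rw [le_div_iff₀ hpos, ← Real.sqrt_mul huu]
  calc |u ⬝ᵥ v| * |mu - lam| = |u ⬝ᵥ (S *ᵥ v)| := by rw [← h, abs_mul, mul_comm]
    _ ≤ Real.sqrt ((u ⬝ᵥ u) * ((S *ᵥ v) ⬝ᵥ (S *ᵥ v))) := Real.abs_le_sqrt hcs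

/-- Euclidean-norm form of the overlap bound (`‖·‖` = the `EuclideanSpace ℝ n` norm). [folklore] -/
theorem sameWindow_overlap_bound_norm (A S : Matrix n n ℝ) (hA : A.IsSymm) (hS : S.IsSymm)
    (u v : n → ℝ) (lam mu : ℝ) (hgap : mu ≠ lam)
    (hv : A *ᵥ v = lam • v) (hu : (A + S) *ᵥ u = mu • u) :
    |u ⬝ᵥ v| ≤ ‖(WithLp.equiv 2 (n → ℝ)).symm u‖ * ‖(WithLp.equiv 2 (n → ℝ)).symm (S *ᵥ v)‖
      / |mu - lam| := by
  have key : ∀ w : n → ℝ, ‖(WithLp.equiv 2 (n → ℝ)).symm w‖ = Real.sqrt (w ⬝ᵥ w) := by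
    intro w
    rw [EuclideanSpace.norm_eq]
    congr 1
    simp [dotProduct, sq]
  rw [key, key]
  exact sameWindow_overlap_bound A S hA hS u v lam mu hgap hv hu

/-! ## Leverage of a planted rank-one term (Sherman–Morrison) -/

/-- `(φ φᵀ) y = ⟨φ, y⟩ φ`. [folklore] -/
theorem vecMulVec_self_mulVec (φ y : n → ℝ) : vecMulVec φ φ *ᵥ y = (φ ⬝ᵥ y) • φ := by
  rw [vecMulVec_mulVec, op_smul_eq_smul]

/-- The rank-one update of a positive definite matrix by `q • φ φᵀ`, `q ≥ 0`, is positive definite.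
[folklore] -/
theorem posDef_add_rankOne {R : Matrix n n ℝ} (hR : R.PosDef) (φ : n → ℝ) {q : ℝ} (hq : 0 ≤ q) :
    (R + q • vecMulVec φ φ).PosDef := by
  refine hR.add_posSemidef ?_
  have h : (vecMulVec φ φ).PosSemidef := by
    simpa using Matrix.posSemidef_vecMulVec_self_star φ
  exact h.smul hq

section Leverage

variable [DecidableEq n]

/-- The explicit solve behind Sherman–Morrison: `(R + q φ φᵀ) ((1 + q t)⁻¹ R⁻¹ φ) = φ` with
`t = φᵀ R⁻¹ φ`. [folklore] -/
theorem rankOne_solve {R : Matrix n n ℝ} (hR : R.PosDef) (φ : n → ℝ) {q : ℝ} (hq : 0 ≤ q) :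
    (R + q • vecMulVec φ φ) *ᵥ ((1 + q * (φ ⬝ᵥ R⁻¹ *ᵥ φ))⁻¹ • (R⁻¹ *ᵥ φ)) = φ := by
  set t := φ ⬝ᵥ R⁻¹ *ᵥ φ with ht
  have ht0 : 0 ≤ t := by
    simpa using hR.inv.posSemidef.dotProduct_mulVec_nonneg φ
  have hden : (1 + q * t) ≠ 0 := by
    have := mul_nonneg hq ht0
    exact ne_of_gt (by linarith)
  have hdetR : IsUnit R.det := (Matrix.isUnit_iff_isUnit_det R).mp hR.isUnit
  have hRy : R *ᵥ (R⁻¹ *ᵥ φ) = φ := by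
    rw [mulVec_mulVec, mul_nonsing_inv R hdetR, one_mulVec]
  rw [mulVec_smul, add_mulVec, hRy, smul_mulVec, vecMulVec_self_mulVec]
  try rw [← ht]
  rw [smul_smul]
  have hφ : φ + (q * t) • φ = (1 + q * t) • φ := by rw [add_smul, one_smul]
  rw [hφ, smul_smul, inv_mul_cancel₀ hden, one_smul]

/-- **Leverage identity (Sherman–Morrison).** For `R` positive definite, `q ≥ 0`:
`1 - q φᵀ(R + q φφᵀ)⁻¹φ = 1 / (1 + q φᵀR⁻¹φ)`. [folklore] -/
theorem leverage_eq (R : Matrix n n ℝ) (hR : R.PosDef) (φ : n → ℝ) (q : ℝ) (hq : 0 ≤ q) :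
    1 - q * (φ ⬝ᵥ (R + q • vecMulVec φ φ)⁻¹ *ᵥ φ) = 1 / (1 + q * (φ ⬝ᵥ R⁻¹ *ᵥ φ)) := by
  set t := φ ⬝ᵥ R⁻¹ *ᵥ φ with ht
  have ht0 : 0 ≤ t := by
    simpa using hR.inv.posSemidef.dotProduct_mulVec_nonneg φ
  have hden : (1 + q * t) ≠ 0 := by
    have := mul_nonneg hq ht0
    exact ne_of_gt (by linarith)
  -- the perturbed matrix is invertible
  have hW : (R + q • vecMulVec φ φ).PosDef := posDef_add_rankOne hR φ hq
  have hdetW : IsUnit (R + q • vecMulVec φ φ).det := (Matrix.isUnit_iff_isUnit_det _).mp hW.isUnit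
  -- its inverse applied to φ is the explicit solve
  have hsolve : (R + q • vecMulVec φ φ)⁻¹ *ᵥ φ = (1 + q * t)⁻¹ • (R⁻¹ *ᵥ φ) := by
    have h := rankOne_solve hR φ hq
    try rw [← ht] at h
    have h2 : (R + q • vecMulVec φ φ)⁻¹ *ᵥ ((R + q • vecMulVec φ φ) *ᵥ ((1 + q * t)⁻¹ • (R⁻¹ *ᵥ φ)))
        = (1 + q * t)⁻¹ • (R⁻¹ *ᵥ φ) := by
      rw [mulVec_mulVec, nonsing_inv_mul _ hdetW, one_mulVec]
    rwa [h] at h2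
  rw [hsolve, dotProduct_smul, smul_eq_mul]
  try rw [← ht]
  field_simp
  ring

/-- The leverage is positive. [folklore] -/
theorem leverage_pos (R : Matrix n n ℝ) (hR : R.PosDef) (φ : n → ℝ) (q : ℝ) (hq : 0 ≤ q) :
    0 < 1 - q * (φ ⬝ᵥ (R + q • vecMulVec φ φ)⁻¹ *ᵥ φ) := by
  rw [leverage_eq R hR φ q hq]
  have ht0 : 0 ≤ φ ⬝ᵥ R⁻¹ *ᵥ φ := by
    simpa using hR.inv.posSemidef.dotProduct_mulVec_nonneg φ
  have := mul_nonneg hq ht0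
  exact div_pos one_pos (by linarith)

/-- The leverage is at most one. [folklore] -/
theorem leverage_le_one (R : Matrix n n ℝ) (hR : R.PosDef) (φ : n → ℝ) (q : ℝ) (hq : 0 ≤ q) :
    1 - q * (φ ⬝ᵥ (R + q • vecMulVec φ φ)⁻¹ *ᵥ φ) ≤ 1 := by
  rw [leverage_eq R hR φ q hq]
  have ht0 : 0 ≤ φ ⬝ᵥ R⁻¹ *ᵥ φ := by
    simpa using hR.inv.posSemidef.dotProduct_mulVec_nonneg φ
  have hden : 1 ≤ 1 + q * (φ ⬝ᵥ R⁻¹ *ᵥ φ) := by nlinarith [mul_nonneg hq ht0]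
  exact div_le_one_of_le₀ hden (by linarith)

/-- Packaged form requested by `pub-rhpf-struct` (their sketch `leverage_pos_le_one`, with the
hypothesis weakened from `0 < q` to `0 ≤ q`). [folklore] -/
theorem leverage_pos_le_one (R : Matrix n n ℝ) (hR : R.PosDef) (φ : n → ℝ) (q : ℝ) (hq : 0 ≤ q) :
    0 < 1 - q * (φ ⬝ᵥ (R + q • vecMulVec φ φ)⁻¹ *ᵥ φ) ∧
      1 - q * (φ ⬝ᵥ (R + q • vecMulVec φ φ)⁻¹ *ᵥ φ) ≤ 1 :=
  ⟨leverage_pos R hR φ q hq, leverage_le_one R hR φ q hq⟩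

end Leverage

end Summit.RiemannHypothesis.RiemannHypothesis.Theorems.PfPersistence.SameWindow
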